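import Mathlib
import Summits.Ventures.PercRepro.TriangleCapBandBase

/-!
# PercRepro — THE CLOSED FORM ON EVERY ROW `a ≥ 4`: EVERY SUB-DIAGONAL `r ≥ 5` ON EVERY CELL `k ≥ 2a + r` (p3,
gen 40; part 161)

By strong induction on `k`, with the degree argument at every level (parts 158–160): on the cell
`m = a (k − a) − r` the max-degree lemma caps every degree by `k − a`; every degree `≥ a` is the convexity bound;
a vertex of degree `d < a` is deleted onto the cell `r + d − a` of the same row at `k − 1` when `r + d ≥ a`
(the envelope, the base rows `1 … 4`, or the induction hypothesis), and onto the envelope at `k − 1` when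
`r + d < a`. `band_stability`: `K₄⁻`-free, `4 ≤ a`, `5 ≤ r`, `2a + r ≤ k`, `m + a² + r = a k` ⇒
`Σ_v d(v)² + r (k − 1 − r) ≤ m k`; **`band_exact_k4m`**: for every `a ≥ 4`, `r ≥ 5`, `k ≥ 2a + r` the maximum
of `2·Σ_v C(d(v), 2)` over the `K₄⁻`-free graphs on `Fin k` with `a (k − a) − r` edges is
`(a (k − a) − r)(k − 2) − r (k − 1 − r)`, attained by `K_{a, k−a}` minus `r` edges at one vertex — the closed
form §10av on every cell of the dense corner with `r ≥ 5` (the rows `a = 3` being part 153). Axioms: standard.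
-/

namespace PercRepro

namespace TriangleCap

namespace C047

open Finset

universe u

variable {V : Type*} [Fintype V] [DecidableEq V]

/-- The cap hypothesis on the cell: `2a + r ≤ k`, `m + a² + r = a k` ⇒ `(a − 1)(k − a + 1) < m`. -/
theorem cap_arith (a k m r : ℕ) (ha : 1 ≤ a) (hk : 2 * a + r ≤ k) (hm : m + a * a + r = a * k) :
    (a - 1) * (k - a + 1) < m := by
  obtain ⟨a', rfl⟩ : ∃ a', a = a' + 1 := ⟨a - 1, by omega⟩
  obtain ⟨j, rfl⟩ : ∃ j, k = 2 * (a' + 1) + r + j := ⟨k - (2 * (a' + 1) + r), by omega⟩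
  have e1 : a' + 1 - 1 = a' := by omega
  have e2 : 2 * (a' + 1) + r + j - (a' + 1) + 1 = a' + r + j + 2 := by omega
  rw [e1, e2]
  nlinarith [hm]

/-- **THE ROWS `a ≥ 4` BY STRONG INDUCTION ON `k`:** on `n` vertices, `K₄⁻`-free, `4 ≤ a`, `5 ≤ r`, `2a + r ≤ n`,
`m + a² + r = a n` ⇒ `Σ_v d(v)² + r (n − 1 − r) ≤ m n`. -/
theorem band_stability_aux (n : ℕ) :
    ∀ (W : Type u) [Fintype W] [DecidableEq W] (D : SimpleGraph W) [DecidableRel D.Adj], Fintype.card W = n →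
      K4mFree D → ∀ a r, 4 ≤ a → 5 ≤ r → 2 * a + r ≤ n → D.edgeFinset.card + a * a + r = a * n →
      ∑ v, deg D v * deg D v + r * (n - 1 - r) ≤ D.edgeFinset.card * n := by
  refine Nat.strong_induction_on n ?_
  intro n ih W _ _ D _ hn hK a r ha hr hk hm
  subst hn
  -- the max-degree cap
  have hcap : ∀ v, deg D v + a ≤ Fintype.card W := fun v =>
    deg_add_le_card_of_dense D hK a (by omega) (by omega)
      (cap_arith a (Fintype.card W) D.edgeFinset.card r (by omega) hk hm) v
  by_cases hdeg : ∀ z, a ≤ deg D z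
  · exact band_stability_of_min_degree D a r (by omega) hcap hdeg (by omega) hm
  push Not at hdeg
  obtain ⟨z, hz⟩ := hdeg
  rcases Nat.lt_or_ge (r + deg D z) a with hcross | hwithin
  · exact band_of_low_degree_cross D hK a r hcap (z := z) (by omega) (by omega) (by omega) hm
  · have hK' := k4mFree_del D hK z
    have hcard' := card_del z
    have hedges' := card_edges_del D z
    have hak : a * Fintype.card W = a * Fintype.card {v : W // v ≠ z} + a := by
      rw [← hcard']
      ring
    have hm' : (del D z).edgeFinset.card + a * a + (r + deg D z - a) = a * Fintype.card {v : W // v ≠ z} := by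
      omega
    have hrow : ∑ v, deg (del D z) v * deg (del D z) v +
        (r + deg D z - a) * (Fintype.card {v : W // v ≠ z} - 1 - (r + deg D z - a)) ≤
        (del D z).edgeFinset.card * Fintype.card {v : W // v ≠ z} := by
      rcases Nat.eq_zero_or_pos (r + deg D z - a) with h0 | hpos
      · rw [h0, zero_mul, add_zero]
        exact sum_deg_sq_le_of_k4mFree (del D z) hK' (by omega)
      · rcases Nat.lt_or_ge (r + deg D z - a) 5 with h5 | h5
        · exact band_row_base (del D z) hK' a (r + deg D z - a) ha hpos (by omega) (by omega) hm'
        · exact ih (Fintype.card {v : W // v ≠ z}) (by omega) {v : W // v ≠ z} (del D z) rfl hK' a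
            (r + deg D z - a) ha h5 (by omega) hm'
    exact band_of_low_degree D a r hcap (z := z) (by omega) hwithin (by omega) hm hrow

/-- **THE CLOSED FORM ON THE ROWS `a ≥ 4`, EVERY SUB-DIAGONAL `r ≥ 5`:** `K₄⁻`-free, `2a + r ≤ k`,
`m + a² + r = a k` ⇒ `Σ_v d(v)² + r (k − 1 − r) ≤ m k`. -/
theorem band_stability (D : SimpleGraph V) [DecidableRel D.Adj] (hK : K4mFree D) (a r : ℕ) (ha : 4 ≤ a)
    (hr : 5 ≤ r) (hk : 2 * a + r ≤ Fintype.card V) (hm : D.edgeFinset.card + a * a + r = a * Fintype.card V) :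
    ∑ v, deg D v * deg D v + r * (Fintype.card V - 1 - r) ≤ D.edgeFinset.card * Fintype.card V :=
  band_stability_aux (Fintype.card V) V D rfl hK a r ha hr hk hm

/-- **THE CLOSED FORM IS EXACT ON THE `K₄⁻`-FREE CLASS ON EVERY CELL `k ≥ 2a + r` OF EVERY ROW `a ≥ 4`,
`r ≥ 5`:** the maximum of `2·Σ_v C(d(v), 2)` over the `K₄⁻`-free graphs on `Fin k` with `a (k − a) − r` edges
is `(a (k − a) − r)(k − 2) − r (k − 1 − r)`, attained by `K_{a, k−a}` minus `r` edges at one vertex. -/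
theorem band_exact_k4m (k a r : ℕ) (ha : 4 ≤ a) (hr : 5 ≤ r) (hk : 2 * a + r ≤ k) :
    (∀ (D : SimpleGraph (Fin k)) [DecidableRel D.Adj], K4mFree D →
        D.edgeFinset.card = a * (k - a) - r →
        2 * cherries D + r * (k - 1 - r) ≤ (a * (k - a) - r) * (k - 2)) ∧
      ∃ (D : SimpleGraph (Fin k)) (_ : DecidableRel D.Adj), K4mFree D ∧
        D.edgeFinset.card = a * (k - a) - r ∧ 2 * cherries D + r * (k - 1 - r) = (a * (k - a) - r) * (k - 2) := by
  obtain ⟨c, hc⟩ : ∃ c, k = a + c := ⟨k - a, by omega⟩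
  have e1 : a * (k - a) = a * c := by rw [hc, Nat.add_sub_cancel_left]
  have hrc : r ≤ a * c := by
    have : c ≤ a * c := Nat.le_mul_of_pos_left c (by omega)
    omega
  obtain ⟨q, hq⟩ : ∃ q, a * c = r + q := ⟨a * c - r, by omega⟩
  rw [e1, hq]
  have e2 : r + q - r = q := by omega
  rw [e2]
  obtain ⟨s, hs⟩ : ∃ s, k = r + 2 + s := ⟨k - (r + 2), by omega⟩
  have e3 : k - 1 - r = s + 1 := by omega
  have e4 : k - 2 = r + s := by omega
  rw [e3, e4]
  constructor
  · intro D _ hK hD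
    have hcard : Fintype.card (Fin k) = k := Fintype.card_fin k
    have hm : D.edgeFinset.card + a * a + r = a * Fintype.card (Fin k) := by
      rw [hcard, hD, hc]
      nlinarith [hq]
    have h1 := band_stability D hK a r ha hr (by rw [hcard]; exact hk) hm
    have h2 := two_mul_cherries_add D
    have h3 := sum_deg_eq D
    rw [hcard, hD, e3] at h1
    rw [hD] at h3
    have hqk : q * k = q * (r + 2 + s) := by rw [hs]
    nlinarith
  · refine ⟨bipMinusStar k a r, inferInstance, k4mFree_bipMinusStar k a r, ?_, ?_⟩
    · have := card_edges_bipMinusStar k a r (by omega) (by omega)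
      rw [e1, hq] at this
      omega
    · have h := two_mul_cherries_bipMinusStar k a r (by omega) (by omega) (by omega)
      rw [e1, hq] at h
      have e5 : 2 * k - r - 3 = r + 2 * s + 1 := by omega
      rw [e5, e4] at h
      nlinarith

end C047

end TriangleCap

end PercRepro
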